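import Summits.Ventures.HodgeRepro2.T5InertThreeTermRecurrence
import Summits.Ventures.HodgeRepro2.T5HeckeCharacterEigenvalue

/-!
# The degree relation of the three-term recurrence at an inert place
(cell pub-hodge-repro2, seat p3)

Tier-5 N3 support. The trivial character of `H(U(antidiag(1, u, 1)), K)` — the action on the spherical
line of the trivial representation, where `T_g` acts by its DEGREE `deg T_g = #(K g K / K)` (seat p8's
T5-92 `heckeSMul_doubleCosetOp_lineRep_one`) — is multiplicative, so the three-term recurrence of file
189 yields a relation among the degrees and the two structure constants:

* `permUnit_mul_cell_mul_inv` / **`inv_cellU_mem_orbit`** / `orbit_inv_cellU_eq` — the Weyl element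
  `w = antidiag(1, 1, 1) ∈ K` conjugates `aₙ` to `aₙ⁻¹`, so `K aₙ⁻¹ K = K aₙ K` (the cells are
  inverse-closed);
* **`coeff_cellU_zero_eq_ncard`** — the constant term of `T₁ · T₁` is `deg T₁`: `d₀ = #(K a₁ K / K)`;
* `coe_heckeSMul_lineRep_one_mul` / `_add` / `_smul` — the trivial character `ε(T) = (T · 1)` on the
  spherical line of `lineRep 1` is multiplicative on double-coset operators, additive and `k`-linear;
* **`degree_relation`** — `deg T₁ · deg T_{n+1} = deg T_{n+2} + cₙ · deg T_{n+1} + dₙ · deg Tₙ` in `k`,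
  with `cₙ, dₙ` the structure constants of file 189;
* **`degree_relation_zero`** — `(deg T₁)² = deg T₂ + c₀ · deg T₁ + deg T₁`.

What stays prose: the degrees themselves (`deg Tₙ = (q³ + 1) q^{4n−3}`, `q = #(R/ϖ)`), from which the
relation returns `cₙ = q − 1` once `dₙ = q⁴` is known (the adjointness relation `dₙ deg Tₙ = deg T_{n+1}`
is not in this file).

Mathlib + this seat's file 189 + seat p8's T5-52 / T5-92 and their imports; no display; no device.
§8(d): uses an L-value-free non-vanishing device: NO.
-/

namespace Summit.Ventures.HodgeRepro2.T5InertDegreeRelation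

open Summit.Ventures.HodgeRepro2.T5CartanCellsDistinct Summit.Ventures.HodgeRepro2.T5HeckeBasisCells
  Summit.Ventures.HodgeRepro2.T5HermitianThreeElements Summit.Ventures.HodgeRepro2.T5UnitaryGroupForm
  Summit.Ventures.HodgeRepro2.T5UnitaryHeckeAdjoint Summit.Ventures.HodgeRepro2.T5HeckeDoubleCoset
  Summit.Ventures.HodgeRepro2.T5HeckeConvolution Summit.Ventures.HodgeRepro2.T5HeckePermutationModule
  Summit.Ventures.HodgeRepro2.T5HeckePolynomialAlgebra Summit.Ventures.HodgeRepro2.T5InertTopCoefficient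
  Summit.Ventures.HodgeRepro2.T5InertThreeTermRecurrence Summit.Ventures.HodgeRepro2.T5HeckeCharacterEigenvalue
  Summit.Ventures.HodgeRepro2.LevelPositivity Summit.Ventures.HodgeRepro2.T5CartanDominant
  Summit.Ventures.HodgeRepro2.T5CartanUniformiser

/-! ## The cells are inverse-closed -/

section Weyl

variable {R E : Type*} [CommRing R] [Field E] [StarRing E] [Algebra R E] [IsFractionRing R E]
  (u : E) {ϖ : R} (hϖ : Irreducible ϖ) (hs : star (algebraMap R E ϖ) = algebraMap R E ϖ)

omit [StarRing E] in
/-- The Weyl element `w = antidiag(1, 1, 1)` conjugates the cell `aₙ = diag(ϖⁿ, 1, ϖ⁻ⁿ)` to its inverse. -/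
theorem permUnit_mul_cell_mul_inv (n : ℕ) :
    permUnit E Fin.revPerm * cell hϖ n * (permUnit E Fin.revPerm)⁻¹ = (cell hϖ n)⁻¹ := by
  rw [← diagonalUnit_eq_cell hϖ n]
  refine permUnit_mul_diagonalUnit_zpow_mul_inv Fin.revPerm (piUnit hϖ) ![(n : ℤ), 0, -(n : ℤ)]
    fun i => ?_
  fin_cases i <;> simp

/-- **The cells are inverse-closed**: `aₙ⁻¹ ∈ K aₙ K`. -/
theorem inv_cellU_mem_orbit (n : ℕ) :
    (((cellU hϖ hs u n)⁻¹ : formUnitaryGroup (J3 u)) :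
        formUnitaryGroup (J3 u) ⧸ hyperspecialSubgroup R (J3 u)) ∈
      MulAction.orbit (hyperspecialSubgroup R (J3 u))
        ((cellU hϖ hs u n : formUnitaryGroup (J3 u)) :
          formUnitaryGroup (J3 u) ⧸ hyperspecialSubgroup R (J3 u)) := by
  set K := hyperspecialSubgroup R (J3 u) with hK
  -- the Weyl element, as an element of `K`
  let w : K := ⟨⟨permUnit E Fin.revPerm, permUnit_rev3_mem u⟩, permUnit_rev_mem_hyperspecial u⟩
  have hw : ((w : K) : formUnitaryGroup (J3 u)) * cellU hϖ hs u n * ((w : K) : formUnitaryGroup (J3 u))⁻¹ =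
      (cellU hϖ hs u n)⁻¹ := by
    apply Subtype.ext
    simp only [Subgroup.coe_mul, Subgroup.coe_inv, coe_cellU]
    exact permUnit_mul_cell_mul_inv hϖ n
  refine MulAction.mem_orbit_iff.2 ⟨w, ?_⟩
  rw [← hw]
  show ((((w : K) : formUnitaryGroup (J3 u)) * cellU hϖ hs u n : formUnitaryGroup (J3 u)) :
      formUnitaryGroup (J3 u) ⧸ K) =
    ((((w : K) : formUnitaryGroup (J3 u)) * cellU hϖ hs u n * ((w : K) : formUnitaryGroup (J3 u))⁻¹ :
      formUnitaryGroup (J3 u)) : formUnitaryGroup (J3 u) ⧸ K)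
  exact (QuotientGroup.mk_mul_of_mem _ (Subgroup.inv_mem _ w.2)).symm

/-- `K aₙ⁻¹ K = K aₙ K` as sets of cosets. -/
theorem orbit_inv_cellU_eq (n : ℕ) :
    MulAction.orbit (hyperspecialSubgroup R (J3 u))
        (((cellU hϖ hs u n)⁻¹ : formUnitaryGroup (J3 u)) :
          formUnitaryGroup (J3 u) ⧸ hyperspecialSubgroup R (J3 u)) =
      MulAction.orbit (hyperspecialSubgroup R (J3 u))
        ((cellU hϖ hs u n : formUnitaryGroup (J3 u)) :
          formUnitaryGroup (J3 u) ⧸ hyperspecialSubgroup R (J3 u)) :=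
  MulAction.orbit_eq_iff.2 (inv_cellU_mem_orbit u hϖ hs n)

end Weyl

/-! ## The constant term of `T₁ · T₁` is the degree of `T₁` -/

section ConstantTerm

variable {R E : Type*} [CommRing R] [Field E] [StarRing E] [Algebra R E] [IsFractionRing R E] [IsDomain R]
  [IsDiscreteValuationRing R] [Finite (IsLocalRing.ResidueField R)]
  (u : E) {ϖ : R} (hϖ : Irreducible ϖ) (hs : star (algebraMap R E ϖ) = algebraMap R E ϖ)

/-- **`d₀ = deg T₁`**: the coefficient of `T₀` in `T₁ · T₁` is `#(K a₁ K / K)` — every coset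
`x K ⊆ K a₁ K` has `x⁻¹ ∈ K a₁⁻¹ K = K a₁ K`. -/
theorem coeff_cellU_zero_eq_ncard (k : Type*) [Field k] :
    (((doubleCosetOp k (hyperspecialSubgroup R (J3 u)) (cellU hϖ hs u 1) *
        doubleCosetOp k (hyperspecialSubgroup R (J3 u)) (cellU hϖ hs u 1) :
        heckeAlgebra k (hyperspecialSubgroup R (J3 u))) :
        Module.End k (MonoidAlgebra k (formUnitaryGroup (J3 u) ⧸ hyperspecialSubgroup R (J3 u))))
      (MonoidAlgebra.single ((1 : formUnitaryGroup (J3 u)) :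
        formUnitaryGroup (J3 u) ⧸ hyperspecialSubgroup R (J3 u)) 1)).coeff
      ((cellU hϖ hs u 0 : formUnitaryGroup (J3 u)) :
        formUnitaryGroup (J3 u) ⧸ hyperspecialSubgroup R (J3 u)) =
    ((MulAction.orbit (hyperspecialSubgroup R (J3 u))
      ((cellU hϖ hs u 1 : formUnitaryGroup (J3 u)) :
        formUnitaryGroup (J3 u) ⧸ hyperspecialSubgroup R (J3 u))).ncard : k) := by
  set K := hyperspecialSubgroup R (J3 u) with hK
  rw [coeff_doubleCosetOp_mul_apply_single_one]
  congr 2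
  refine Set.inter_eq_left.2 fun x hx => ?_
  have hout : ((Quotient.out x : formUnitaryGroup (J3 u)) : formUnitaryGroup (J3 u) ⧸ K) = x :=
    QuotientGroup.out_eq' x
  show ((Quotient.out x)⁻¹ • ((cellU hϖ hs u 0 : formUnitaryGroup (J3 u)) : formUnitaryGroup (J3 u) ⧸ K) :
      formUnitaryGroup (J3 u) ⧸ K) ∈
    MulAction.orbit K ((cellU hϖ hs u 1 : formUnitaryGroup (J3 u)) : formUnitaryGroup (J3 u) ⧸ K)
  rw [cellU_zero, MulAction.Quotient.smul_mk, smul_eq_mul, mul_one, ← orbit_inv_cellU_eq u hϖ hs 1,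
    ← T5HeckeTranspose.mem_orbit_inv_iff, inv_inv, hout]
  exact hx

end ConstantTerm

/-! ## The trivial character of a Hecke algebra -/

section TrivialCharacter

variable {G : Type*} [Group G] {k : Type*} [Field k] {K : Subgroup G}

/-- The trivial representation `lineRep 1` is trivial on `K`. -/
theorem lineRep_one_trivial : ∀ κ ∈ K, (1 : G →* kˣ) κ = 1 := fun _ _ => rfl

/-- On the spherical line of the trivial representation, `T_g · T_h` acts by `deg T_g · deg T_h`. -/
theorem coe_heckeSMul_lineRep_one_mul (g h : G) [Finite (MulAction.orbit K (g : G ⧸ K))]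
    [Finite (MulAction.orbit K (h : G ⧸ K))] (v : invariants (lineRep (1 : G →* kˣ)) K) :
    ((heckeSMul (lineRep (1 : G →* kˣ)) (doubleCosetOp k K g * doubleCosetOp k K h) v :
        invariants (lineRep (1 : G →* kˣ)) K) : k) =
      ((MulAction.orbit K (g : G ⧸ K)).ncard : k) * ((MulAction.orbit K (h : G ⧸ K)).ncard : k) * (v : k) := by
  have hg : heckeSMul (lineRep (1 : G →* kˣ)) (doubleCosetOp k K g) v =
      ((MulAction.orbit K (g : G ⧸ K)).ncard : k) • v := by
    apply Subtype.ext
    rw [heckeSMul_doubleCosetOp_lineRep_one, Submodule.coe_smul, smul_eq_mul]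
  rw [heckeSMul_mul, hg, heckeSMul_smul_right, Submodule.coe_smul, smul_eq_mul,
    heckeSMul_doubleCosetOp_lineRep_one, mul_assoc]

/-- The trivial character is additive. -/
theorem coe_heckeSMul_add (T T' : heckeAlgebra k K) (v : invariants (lineRep (1 : G →* kˣ)) K) :
    ((heckeSMul (lineRep (1 : G →* kˣ)) (T + T') v : invariants (lineRep (1 : G →* kˣ)) K) : k) =
      ((heckeSMul (lineRep (1 : G →* kˣ)) T v : invariants (lineRep (1 : G →* kˣ)) K) : k) +
        ((heckeSMul (lineRep (1 : G →* kˣ)) T' v : invariants (lineRep (1 : G →* kˣ)) K) : k) := by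
  rw [heckeSMul_add_left, Submodule.coe_add]

/-- The trivial character is `k`-linear. -/
theorem coe_heckeSMul_smul (c : k) (T : heckeAlgebra k K) (v : invariants (lineRep (1 : G →* kˣ)) K) :
    ((heckeSMul (lineRep (1 : G →* kˣ)) (c • T) v : invariants (lineRep (1 : G →* kˣ)) K) : k) =
      c * ((heckeSMul (lineRep (1 : G →* kˣ)) T v : invariants (lineRep (1 : G →* kˣ)) K) : k) := by
  rw [heckeSMul_smul_left, Submodule.coe_smul, smul_eq_mul]

end TrivialCharacter

/-! ## The degree relation -/

section Degree

variable {R E : Type*} [CommRing R] [Field E] [StarRing E] [Algebra R E] [IsFractionRing R E] [IsDomain R]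
  [IsDiscreteValuationRing R] [Finite (IsLocalRing.ResidueField R)]
  (hstar : ∀ x : E, IsLocalization.IsInteger R x → IsLocalization.IsInteger R (star x))
  (u : E) (hsu : star u = u) (hu0 : u ≠ 0) (hu : IsLocalization.IsInteger R u)
  (hu' : IsLocalization.IsInteger R u⁻¹) {ϖ : R} (hϖ : Irreducible ϖ)
  (hs : star (algebraMap R E ϖ) = algebraMap R E ϖ) (k : Type*) [Field k]

include hstar hsu hu0 hu hu' in
/-- **The degree relation**: `deg T₁ · deg T_{n+1} = deg T_{n+2} + cₙ · deg T_{n+1} + dₙ · deg Tₙ` in `k`,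
where `cₙ`, `dₙ` are the structure constants of file 189's three-term recurrence and
`deg T_m = #(K a_m K / K)` (the trivial character applied to `T₁ · T_{n+1} = T_{n+2} + cₙ T_{n+1} + dₙ Tₙ`). -/
theorem degree_relation (n : ℕ) :
    ((MulAction.orbit (hyperspecialSubgroup R (J3 u))
        ((cellU hϖ hs u 1 : formUnitaryGroup (J3 u)) :
          formUnitaryGroup (J3 u) ⧸ hyperspecialSubgroup R (J3 u))).ncard : k) *
      ((MulAction.orbit (hyperspecialSubgroup R (J3 u))
        ((cellU hϖ hs u (n + 1) : formUnitaryGroup (J3 u)) :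
          formUnitaryGroup (J3 u) ⧸ hyperspecialSubgroup R (J3 u))).ncard : k) =
    ((MulAction.orbit (hyperspecialSubgroup R (J3 u))
        ((cellU hϖ hs u (n + 1 + 1) : formUnitaryGroup (J3 u)) :
          formUnitaryGroup (J3 u) ⧸ hyperspecialSubgroup R (J3 u))).ncard : k) +
      (((doubleCosetOp k (hyperspecialSubgroup R (J3 u)) (cellU hϖ hs u 1) *
          doubleCosetOp k (hyperspecialSubgroup R (J3 u)) (cellU hϖ hs u (n + 1)) :
          heckeAlgebra k (hyperspecialSubgroup R (J3 u))) :
          Module.End k (MonoidAlgebra k (formUnitaryGroup (J3 u) ⧸ hyperspecialSubgroup R (J3 u))))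
        (MonoidAlgebra.single ((1 : formUnitaryGroup (J3 u)) :
          formUnitaryGroup (J3 u) ⧸ hyperspecialSubgroup R (J3 u)) 1)).coeff
        ((cellU hϖ hs u (n + 1) : formUnitaryGroup (J3 u)) :
          formUnitaryGroup (J3 u) ⧸ hyperspecialSubgroup R (J3 u)) *
        ((MulAction.orbit (hyperspecialSubgroup R (J3 u))
          ((cellU hϖ hs u (n + 1) : formUnitaryGroup (J3 u)) :
            formUnitaryGroup (J3 u) ⧸ hyperspecialSubgroup R (J3 u))).ncard : k) +
      (((doubleCosetOp k (hyperspecialSubgroup R (J3 u)) (cellU hϖ hs u 1) *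
          doubleCosetOp k (hyperspecialSubgroup R (J3 u)) (cellU hϖ hs u (n + 1)) :
          heckeAlgebra k (hyperspecialSubgroup R (J3 u))) :
          Module.End k (MonoidAlgebra k (formUnitaryGroup (J3 u) ⧸ hyperspecialSubgroup R (J3 u))))
        (MonoidAlgebra.single ((1 : formUnitaryGroup (J3 u)) :
          formUnitaryGroup (J3 u) ⧸ hyperspecialSubgroup R (J3 u)) 1)).coeff
        ((cellU hϖ hs u n : formUnitaryGroup (J3 u)) :
          formUnitaryGroup (J3 u) ⧸ hyperspecialSubgroup R (J3 u)) *
        ((MulAction.orbit (hyperspecialSubgroup R (J3 u))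
          ((cellU hϖ hs u n : formUnitaryGroup (J3 u)) :
            formUnitaryGroup (J3 u) ⧸ hyperspecialSubgroup R (J3 u))).ncard : k) := by
  set K := hyperspecialSubgroup R (J3 u) with hK
  -- the spherical vector `1` of the trivial representation (kept opaque)
  obtain ⟨v, hv⟩ : ∃ v : invariants (lineRep (1 : formUnitaryGroup (J3 u) →* kˣ)) K, (v : k) = 1 :=
    ⟨⟨1, mem_invariants_lineRep 1 lineRep_one_trivial 1⟩, rfl⟩
  have h3 := mul_cellU_eq_three_term hstar u hsu hu0 hu hu' hϖ hs k n
  rw [heckeBasisCells_apply, heckeBasisCells_apply, heckeBasisCells_apply, heckeBasisCells_apply] at h3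
  have h4 := congrArg (fun T : heckeAlgebra k K =>
    ((heckeSMul (lineRep (1 : formUnitaryGroup (J3 u) →* kˣ)) T v :
      invariants (lineRep (1 : formUnitaryGroup (J3 u) →* kˣ)) K) : k)) h3
  have e1 := coe_heckeSMul_lineRep_one_mul (K := K) (cellU hϖ hs u 1) (cellU hϖ hs u (n + 1)) v
  have e6 := heckeSMul_doubleCosetOp_lineRep_one (K := K) (k := k) (cellU hϖ hs u (n + 1 + 1)) v
  have e7 := heckeSMul_doubleCosetOp_lineRep_one (K := K) (k := k) (cellU hϖ hs u (n + 1)) v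
  have e8 := heckeSMul_doubleCosetOp_lineRep_one (K := K) (k := k) (cellU hϖ hs u n) v
  rw [hv, mul_one] at e1 e6 e7 e8
  refine e1.symm.trans (h4.trans ?_)
  refine (coe_heckeSMul_add _ _ v).trans (congrArg₂ (· + ·) ?_ ?_)
  · refine (coe_heckeSMul_add _ _ v).trans (congrArg₂ (· + ·) e6 ?_)
    exact (coe_heckeSMul_smul _ _ v).trans (congrArg (HMul.hMul _) e7)
  · exact (coe_heckeSMul_smul _ _ v).trans (congrArg (HMul.hMul _) e8)

include hstar hsu hu0 hu hu' in
/-- **The degree relation at `n = 0`**: `(deg T₁)² = deg T₂ + c₀ · deg T₁ + deg T₁` (the constant term of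
`T₁ · T₁` being `deg T₁`, `coeff_cellU_zero_eq_ncard`). -/
theorem degree_relation_zero :
    ((MulAction.orbit (hyperspecialSubgroup R (J3 u))
        ((cellU hϖ hs u 1 : formUnitaryGroup (J3 u)) :
          formUnitaryGroup (J3 u) ⧸ hyperspecialSubgroup R (J3 u))).ncard : k) *
      ((MulAction.orbit (hyperspecialSubgroup R (J3 u))
        ((cellU hϖ hs u 1 : formUnitaryGroup (J3 u)) :
          formUnitaryGroup (J3 u) ⧸ hyperspecialSubgroup R (J3 u))).ncard : k) =
    ((MulAction.orbit (hyperspecialSubgroup R (J3 u))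
        ((cellU hϖ hs u 2 : formUnitaryGroup (J3 u)) :
          formUnitaryGroup (J3 u) ⧸ hyperspecialSubgroup R (J3 u))).ncard : k) +
      (((doubleCosetOp k (hyperspecialSubgroup R (J3 u)) (cellU hϖ hs u 1) *
          doubleCosetOp k (hyperspecialSubgroup R (J3 u)) (cellU hϖ hs u 1) :
          heckeAlgebra k (hyperspecialSubgroup R (J3 u))) :
          Module.End k (MonoidAlgebra k (formUnitaryGroup (J3 u) ⧸ hyperspecialSubgroup R (J3 u))))
        (MonoidAlgebra.single ((1 : formUnitaryGroup (J3 u)) :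
          formUnitaryGroup (J3 u) ⧸ hyperspecialSubgroup R (J3 u)) 1)).coeff
        ((cellU hϖ hs u 1 : formUnitaryGroup (J3 u)) :
          formUnitaryGroup (J3 u) ⧸ hyperspecialSubgroup R (J3 u)) *
        ((MulAction.orbit (hyperspecialSubgroup R (J3 u))
          ((cellU hϖ hs u 1 : formUnitaryGroup (J3 u)) :
            formUnitaryGroup (J3 u) ⧸ hyperspecialSubgroup R (J3 u))).ncard : k) +
      ((MulAction.orbit (hyperspecialSubgroup R (J3 u))
        ((cellU hϖ hs u 1 : formUnitaryGroup (J3 u)) :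
          formUnitaryGroup (J3 u) ⧸ hyperspecialSubgroup R (J3 u))).ncard : k) *
        ((MulAction.orbit (hyperspecialSubgroup R (J3 u))
          ((cellU hϖ hs u 0 : formUnitaryGroup (J3 u)) :
            formUnitaryGroup (J3 u) ⧸ hyperspecialSubgroup R (J3 u))).ncard : k) := by
  have h := degree_relation hstar u hsu hu0 hu hu' hϖ hs k 0
  simp only [Nat.zero_add, Nat.reduceAdd] at h
  rw [coeff_cellU_zero_eq_ncard] at h
  exact h

end Degree

end Summit.Ventures.HodgeRepro2.T5InertDegreeRelation
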